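import Summits.QuantumFields.YangMills.Theorems.FluctuationComparisonRegPrIntLS2BetaLiftGradientFeed
import Summits.QuantumFields.YangMills.Theorems.FluctuationComparisonRegPrIntLS2BetaSmoothResidualCopyOfLetters
import HarnessLib

/-!
# S2β · GAP♯∘ — (α-SIZES) «THE SIZES AT THE SMOOTH-MOVED TRIPLE»: at the triple `((u↓)⁻¹•V, û•(r•U₀), u⁻¹•U)` — `r•U₀` the smooth residual copy of the minimiser
# (✓p840422), `û` ANY fine lift with small fine gradient (✓p840262), `u` Thm 2's gauge for the pair `(r•U₀, U)` — the relative field is `E·E′` and EVERY size the rows read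
# (`E′`, the new background's bonds, the lift's walk gradients) is FINE-SMALL, with every input named

Cell `ym3-torus` (rung R3 = continuum `SU(2)` YM₃ on T³ at fixed lattice data — NOT d = 4, NOT infinite volume, NOT a mass gap, NOT Clay).  Width seat
`ym-ust-20520-w5` (gen 29), explicit-unit helper on crux `stmt-QuantumFields-20520`, LINE g18-1 S2β (registry untouched), organ GAP♯∘, node (RES-u).  The (α) KNIT is split
(bus 2026-09-01T03:04Z): DOORS = px16 g24 `…BodyDoorSmoothMoved` (`BODY((u↓)⁻¹•V, û•(r•U₀), u⁻¹•U) ↔ BODY(V, U₀, U)` + admissibility), SIZES = THIS FILE.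
* §1 `relChord_smoothMoved (hrep : u⁻¹•U = E·W)`: `(u⁻¹•U) b·((û•W) b)⁻¹ = E b·(W b·((û•W) b)⁻¹)` — the moved pair's relative chord is `E·E′` (px16's ✓`relChord_thm2Moved`, generic lift).
* §2 ★`dist1_movedCopyRel_le (hcomm) (hσ hτ hγ)`: `dist1 (W b·((û•W) b)⁻¹) ≤ 0 + 2στ + γ`; `SU(n)`: ★`dist1_movedCopyRel_le_SU (hσ hγ) : ≤ 4σ + γ` (✓p839678 §2 at `X := W`, `c := û`,
  closeness `0`; `hγ` = (RES-u.7)'s fine-gradient clause VERBATIM).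
* §3 `dist1_gaugeAct_le_add`: `dist1 ((û•W) b) ≤ dist1 (W b) + dist1 (û b₊·(û b₋)⁻¹)`; ★`dist1_gaugeAct_le_of_bounds (hσ hγ) : dist1 ((û•W) b) ≤ σ + γ` — the NEW background's bond class
  (px13's FRAME-CHANGE `hσ`).
* §4 px13's currencies on `SU(2)`: `norm_movedCopyRel_sub_one_le` (`‖E′ − 1‖ ≤ 4σ + γ`, FEED `hX`, `dist1 = ‖·−1‖` by `rfl`); `walkGrad_le_of_bondGrad` (`dist1 (û x·(û (walkEnd x w))⁻¹) ≤ |w|·γ`,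
  FRAME-CHANGE `hg` at `g := û`, ✓p840003 `dist1_walkGrad_le_of_bondGrad`).
* §5 ★★★`exists_smoothMoved_sizes` — THE ∃-PACKAGE in dependency order: from the (7σ)⁺ letters {argmin, `hBG`@K arcs, (BKG), √θ-gauge, window} FIRST `∃ r` (residual, argmin kept,
  `dist1 ((r•U₀) b) ≤ σ̃ := s + 2π·τ_β·η`); THEN for EVERY coarse `t` with coarse-bond gradient `τ′ ≤ 1∕8` (the consumer takes `t := (u↓)⁻¹` for Thm 2's `u` of the pair `(r•U₀, U)`,
  `τ′` from ✓p839678 §3 ∕ ✓p840003 §5) `∃ û` with `û↓ = t` and the three sizes `4σ̃ + γ`, `σ̃ + γ`, `|w|·γ`, `γ := 2π·τ′·η` (✓p840262).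
`--kind proof --supports stmt-QuantumFields-20520 --as helper`, DEFINITION-FREE (0 `def`, 0 `instance`, 0 `sorry`; default heartbeats).

HONEST.  Group algebra and composition over landed letters; `hrep` (Thm 2 run on the pair `(r•U₀, U)` — the (R-3) lineage's reading of ✓`B8Thm2AtT3Members`, UNPROVED at `L = 3`),
`hgArc` (= `hBG` at level `K`, a CONJECTURE's instance), `hBKG`, `hσV`, the window `τ_β ≤ 1∕8`, `hgrad` are HYPOTHESES; nothing of Bałaban's analysis is asserted or proved
([Balaban1985Averaging] (8) p.18, (11)–(13) p.19; [Balaban1985RegularSpaces] (1.29) p.81, Thm 2 p.83, (1.36)–(1.38) p.82; [Balaban1985Variational] Thm 1 (8) p.279); GAP♯∘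
(`stub_uniformFibreGapOrbit`, 0∕5), the five REGISTERED stubs, S2β, crux 20520, 19936, 19200, `YM3TorusSU2` NOT proved; no summit statement is proved by a helper; rung R3 =
SU(2) YM₃ on T³ — NOT d = 4, NOT infinite volume, NOT a mass gap, NOT Clay; the Yang–Mills mass gap is NOT proved.
-/

set_option autoImplicit false

noncomputable section

namespace Summit.QuantumFields.YangMills.Theorems.FluctuationComparisonRegPrIntLS2BetaSmoothMovedSizes

open Literature.MathematicalPhysics.QuantumLattice (su2Quat)
open Literature.MathematicalPhysics.QuantumFieldTheory.Balaban1983to89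
open T4Continuum T3ContinuumYM3Torus T3UnitScaleTilt T3TiltDescent T3LevelShift
open T3UnitLawDensityEML (ℰp)
open T3ConstrainedMinimiser (fibre)
open T3PrintedRegularMinimiser (minActionRegPr)
open T3PrintedRegularOrbits (descTransf)
open T4ExpWindowSmallField (logVec)
open ExpMeanLog (deltaSU)
open Summit.QuantumFields.YangMills.Theorems.FluctuationComparisonRegPrIntLS2BetaResidualCommutatorLetter
  (dist1_rel_blockRegauged_le dist1_rel_blockRegauged_le_SU)
open Summit.QuantumFields.YangMills.Theorems.FluctuationComparisonRegPrIntLS2BetaLiftGradientFeed (dist1_walkGrad_le_of_bondGrad)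
open Summit.QuantumFields.YangMills.Theorems.FluctuationComparisonRegPrIntLS2BetaSmoothResidualCopyOfLetters (exists_smoothResidualCopy_of_letters)
open Summit.QuantumFields.YangMills.Theorems.FluctuationComparisonRegPrIntLS2BetaLipschitzLift (exists_lipschitzLift)

/-! ## §1 The relative chord of the moved pair -/

section Generic

variable {P : Params} {j : ℕ} {G : Type*} [GaugeGroup G]

/-- **THE RELATIVE CHORD OF THE MOVED PAIR IS `E·E′`** for ANY lift `û`: if `u⁻¹•U = E·W` bondwise (Thm 2's representative of the pair `(W, U)`), then against the moved
background `û•W` the relative bond variable is `E b·(W b·((û•W) b)⁻¹)`. [cite: Balaban1985RegularSpaces, Thm 2 p.83, (1.36)-(1.37) p.82] -/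
theorem relChord_smoothMoved (u û : Site P j → G) (E : PBond P j → G) (W U : GaugeField P j G)
    (hrep : GaugeField.gaugeAct (fun x => (u x)⁻¹) U = fun b => E b * W b) (b : PBond P j) :
    GaugeField.gaugeAct (fun x => (u x)⁻¹) U b * (GaugeField.gaugeAct û W b)⁻¹ = E b * (W b * (GaugeField.gaugeAct û W b)⁻¹) := by
  rw [hrep, mul_assoc]

/-! ## §2 The size of `E′ = W·(û•W)⁻¹` -/

/-- Closeness `0` of a field to itself. [folklore] -/
theorem dist1_rel_self_le' (W : GaugeField P j G) : ∀ b : PBond P j, dist1 (W b * (W b)⁻¹) ≤ (0 : ℝ) := fun b => by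
  rw [mul_inv_cancel, GaugeGroup.dist1_one]

/-- ★ **`E′` IS SMALL** (generic edition): background bonds `≤ σ`, lift values `≤ τ`, lift fine gradient `≤ γ` ⟹ `dist1 (W b·((û•W) b)⁻¹) ≤ 0 + 2στ + γ`
(✓`dist1_rel_blockRegauged_le` at `X := W`, `c := û`). [cite: Balaban1985Averaging, (8) p.18] -/
theorem dist1_movedCopyRel_le (hcomm : ∀ g h : G, dist1 (g * h * g⁻¹ * h⁻¹) ≤ 2 * dist1 g * dist1 h)
    {W : GaugeField P j G} {û : Site P j → G} {σ τ γ : ℝ}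
    (hσ : ∀ b : PBond P j, dist1 (W b) ≤ σ) (hτ : ∀ x : Site P j, dist1 (û x) ≤ τ)
    (hγ : ∀ b : PBond P j, dist1 (û b.tgt * (û b.src)⁻¹) ≤ γ) (b : PBond P j) :
    dist1 (W b * (GaugeField.gaugeAct û W b)⁻¹) ≤ 0 + 2 * σ * τ + γ :=
  dist1_rel_blockRegauged_le hcomm (X := W) (c := û) (dist1_rel_self_le' W) hσ hτ hγ b

/-! ## §3 The new background's bond class -/

/-- `dist1 ((û•W) b) ≤ dist1 (W b) + dist1 (û b₊·(û b₋)⁻¹)` (`(û•W) b = (û b₋·W b·û b₋⁻¹)·(û b₋·û b₊⁻¹)`). [cite: Balaban1985Averaging, (8) p.18] -/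
theorem dist1_gaugeAct_le_add (û : Site P j → G) (W : GaugeField P j G) (b : PBond P j) :
    dist1 (GaugeField.gaugeAct û W b) ≤ dist1 (W b) + dist1 (û b.tgt * (û b.src)⁻¹) := by
  have e : GaugeField.gaugeAct û W b = (û b.src * W b * (û b.src)⁻¹) * (û b.tgt * (û b.src)⁻¹)⁻¹ := by
    show û b.src * W b * (û b.tgt)⁻¹ = _
    rw [mul_inv_rev, inv_inv, ← mul_assoc, inv_mul_cancel_right]
  rw [e]
  refine (GaugeGroup.dist1_mul_le _ _).trans (add_le_add (le_of_eq (GaugeGroup.dist1_conj _ _)) (le_of_eq (GaugeGroup.dist1_inv _)))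

/-- ★ **THE NEW BACKGROUND HAS SMALL BONDS**: `dist1 (W b) ≤ σ`, lift fine gradient `≤ γ` ⟹ `dist1 ((û•W) b) ≤ σ + γ` on every bond. [cite: Balaban1985Averaging, (8) p.18] -/
theorem dist1_gaugeAct_le_of_bounds {W : GaugeField P j G} {û : Site P j → G} {σ γ : ℝ}
    (hσ : ∀ b : PBond P j, dist1 (W b) ≤ σ) (hγ : ∀ b : PBond P j, dist1 (û b.tgt * (û b.src)⁻¹) ≤ γ) :
    ∀ b : PBond P j, dist1 (GaugeField.gaugeAct û W b) ≤ σ + γ :=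
  fun b => (dist1_gaugeAct_le_add û W b).trans (add_le_add (hσ b) (hγ b))

/-- px13's FRAME-CHANGE `hg` for the lift itself: a per-bond gradient `≤ γ` gives `dist1 (û x·(û (walkEnd x w))⁻¹) ≤ |w|·γ` (✓`dist1_walkGrad_le_of_bondGrad`).
[cite: Balaban1985Averaging, (8)-(9) p.18] -/
theorem walkGrad_le_of_bondGrad {û : Site P j → G} {γ : ℝ} (hγ : ∀ b : PBond P j, dist1 (û b.tgt * (û b.src)⁻¹) ≤ γ) :
    ∀ (x : Site P j) (w : List (Letter P.d)), dist1 (û x * (û (walkEnd x w))⁻¹) ≤ (w.length : ℝ) * γ :=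
  dist1_walkGrad_le_of_bondGrad hγ

end Generic

section SU

variable {P : Params} {j : ℕ} {N : Type*} [Fintype N] [DecidableEq N] [Nonempty N]

/-- ★ **`E′` IS SMALL ON `SU(n)`**: `dist1 (W b) ≤ σ`, lift fine gradient `≤ γ` ⟹ `dist1 (W b·((û•W) b)⁻¹) ≤ 4σ + γ` (✓`dist1_rel_blockRegauged_le_SU`, `X := W`, `c := û`).
[cite: Balaban1985Averaging, (8) p.18] -/
theorem dist1_movedCopyRel_le_SU {W : GaugeField P j (Matrix.specialUnitaryGroup N ℂ)} {û : Site P j → Matrix.specialUnitaryGroup N ℂ} {σ γ : ℝ}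
    (hσ : ∀ b : PBond P j, dist1 (W b) ≤ σ) (hγ : ∀ b : PBond P j, dist1 (û b.tgt * (û b.src)⁻¹) ≤ γ) (b : PBond P j) :
    dist1 (W b * (GaugeField.gaugeAct û W b)⁻¹) ≤ 4 * σ + γ := by
  have h := dist1_rel_blockRegauged_le_SU (X := W) (c := û) (dist1_rel_self_le' W) hσ hγ b
  linarith

end SU

/-! ## §4 `SU(2)`: (RES-u.5)'s currency -/

section SU2

open scoped Matrix.Norms.L2Operator

variable {P : Params} {j : ℕ}

/-- px13's FEED `hX : ∀ b, ‖X b − 1‖ ≤ q` for `X := E′ = W·(û•W)⁻¹` read as matrices: `q := 4σ + γ` (`dist1 = ‖· − 1‖`, lit ✓`T4ExpWindowSmallField.dist1_eq_norm_coe_sub_one`, `rfl`).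
[cite: Balaban1985Averaging, (8) p.18, (19) p.21] -/
theorem norm_movedCopyRel_sub_one_le {W : GaugeField P j (Matrix.specialUnitaryGroup (Fin 2) ℂ)} {û : Site P j → Matrix.specialUnitaryGroup (Fin 2) ℂ}
    {σ γ : ℝ} (hσ : ∀ b : PBond P j, dist1 (W b) ≤ σ) (hγ : ∀ b : PBond P j, dist1 (û b.tgt * (û b.src)⁻¹) ≤ γ) :
    ∀ b : PBond P j, ‖((W b * (GaugeField.gaugeAct û W b)⁻¹ : Matrix.specialUnitaryGroup (Fin 2) ℂ) : Matrix (Fin 2) (Fin 2) ℂ) - 1‖ ≤ 4 * σ + γ :=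
  fun b => by
    rw [← T4ExpWindowSmallField.dist1_eq_norm_coe_sub_one]
    exact dist1_movedCopyRel_le_SU hσ hγ b

end SU2

/-! ## §5 The ∃-package over the letters, in dependency order -/

section Package

variable (F : T3Family) {J K : ℕ} (hJK : J ≤ K)

/-- ★★★ **THE SIZES AT THE SMOOTH-MOVED TRIPLE, FROM THE LETTERS** (dependency order `r` → `u` → `û`).  From the (7σ)⁺ letters — `U₀` in the argmin set over `V`, arcs of `g•U₀`
`≤ s` (`hBG` read at level `K`), the (BKG) binder (✓p840154's text) with its window clauses, the datum's bonds `≤ σ_V`, the window `τ_β ≤ 1∕8` — FIRST a residual `r` with `r•U₀` in the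
same argmin set and `dist1 ((r•U₀) b) ≤ σ̃ := s + 2π·τ_β·(L⁻¹)^{K−J}`; THEN, for EVERY coarse `t` with coarse-bond gradient `τ′ ∈ [0, 1∕8]` (the knit takes `t := (u↓)⁻¹` for Thm 2's
gauge `u` of the pair `(r•U₀, U)`, `τ′` from the defect identity), a fine lift `û` of `t` such that, with `γ := 2π·τ′·(L⁻¹)^{K−J}`: `dist1 ((r•U₀) b·((û•(r•U₀)) b)⁻¹) ≤ 4σ̃ + γ`
(`E′`), `dist1 ((û•(r•U₀)) b) ≤ σ̃ + γ` (new background), `dist1 (û x·(û (walkEnd x w))⁻¹) ≤ |w|·γ` (frame change) — all fine-small.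
[cite: Balaban1985Averaging, (8) p.18, (11)-(13) p.19; Balaban1985Variational, Thm 1 (8) p.279; Balaban1985RegularSpaces, Thm 2 p.83] -/
theorem exists_smoothMoved_sizes {γ' b₀ p₀ ε₀ : ℝ} {g : Site (F.P K) 0 → Matrix.specialUnitaryGroup (Fin 2) ℂ}
    {V : GaugeField (F.P J) 0 (Matrix.specialUnitaryGroup (Fin 2) ℂ)} {U₀ : GaugeField (F.P K) 0 (Matrix.specialUnitaryGroup (Fin 2) ℂ)}
    {s C_B α σV : ℝ}
    (hU₀ : U₀ ∈ {U' : GaugeField (F.P K) 0 (Matrix.specialUnitaryGroup (Fin 2) ℂ) | U' ∈ fibre F ℰp J K hJK V ∧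
      U' ∈ histGood F ℰp (θBal F.L γ' b₀ p₀) K J ∧ wilsonAction4 U' = minActionRegPr F J K hJK ε₀ V})
    (hgArc : ∀ e : PBond (F.P K) 0, ‖logVec (su2Quat (GaugeField.gaugeAct g U₀ e))‖ ≤ s) (hCB : 0 ≤ C_B) (hα : 0 ≤ α)
    (hBKG : ∀ t, t ≤ K - J → ∀ p : Plaq (F.P K) t,
      dist1 (GaugeField.plaqHol (Averaging.iter (fun k => BlockAveraging.blockAvg (P := F.P K) (j := k) ℰp) t U₀) p) ≤
        C_B * α * (F.L : ℝ) ^ (2 * t) * ((F.L : ℝ)⁻¹) ^ (2 * (K - J)))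
    (hδ : ((((3 + 2) * F.L : ℕ) : ℝ) ^ 2 / 4) * (C_B * α) < deltaSU (Fin 2))
    (h6 : ((((3 + 2) * F.L : ℕ) : ℝ) ^ 2 / 4) * (C_B * α) ≤ 1 / 6)
    (hσV : ∀ B : PBond (F.P J) 0, dist1 (V B) ≤ σV)
    (hτ0 : 0 ≤ ((F.L : ℝ) ^ (K - J) * s + ((3 + 2) ^ 2 * (F.L : ℝ) / (2 * ((F.L : ℝ) - 1))) * (C_B * α)) + σV)
    (hτ : ((F.L : ℝ) ^ (K - J) * s + ((3 + 2) ^ 2 * (F.L : ℝ) / (2 * ((F.L : ℝ) - 1))) * (C_B * α)) + σV ≤ 1 / 8) :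
    ∃ r : Site (F.P K) 0 → Matrix.specialUnitaryGroup (Fin 2) ℂ,
      (∀ U : GaugeField (F.P K) 0 (Matrix.specialUnitaryGroup (Fin 2) ℂ),
          descendTo F ℰp J K hJK (GaugeField.gaugeAct r U) = descendTo F ℰp J K hJK U) ∧
        GaugeField.gaugeAct r U₀ ∈ {U' : GaugeField (F.P K) 0 (Matrix.specialUnitaryGroup (Fin 2) ℂ) | U' ∈ fibre F ℰp J K hJK V ∧
          U' ∈ histGood F ℰp (θBal F.L γ' b₀ p₀) K J ∧ wilsonAction4 U' = minActionRegPr F J K hJK ε₀ V} ∧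
        (∀ b : PBond (F.P K) 0, dist1 (GaugeField.gaugeAct r U₀ b) ≤
          s + 2 * Real.pi * (((F.L : ℝ) ^ (K - J) * s + ((3 + 2) ^ 2 * (F.L : ℝ) / (2 * ((F.L : ℝ) - 1))) * (C_B * α)) + σV) * ((F.L : ℝ)⁻¹) ^ (K - J)) ∧
        ∀ (t : Site (F.P J) 0 → Matrix.specialUnitaryGroup (Fin 2) ℂ) (τ' : ℝ), 0 ≤ τ' → τ' ≤ 1 / 8 →
          (∀ B : PBond (F.P J) 0, dist1 (t B.tgt * (t B.src)⁻¹) ≤ τ') →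
          ∃ û : Site (F.P K) 0 → Matrix.specialUnitaryGroup (Fin 2) ℂ,
            descTransf F J K hJK û = t ∧
            (∀ b : PBond (F.P K) 0, dist1 (GaugeField.gaugeAct r U₀ b * (GaugeField.gaugeAct û (GaugeField.gaugeAct r U₀) b)⁻¹) ≤
              4 * (s + 2 * Real.pi * (((F.L : ℝ) ^ (K - J) * s + ((3 + 2) ^ 2 * (F.L : ℝ) / (2 * ((F.L : ℝ) - 1))) * (C_B * α)) + σV) *
                ((F.L : ℝ)⁻¹) ^ (K - J)) + 2 * Real.pi * τ' * ((F.L : ℝ)⁻¹) ^ (K - J)) ∧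
            (∀ b : PBond (F.P K) 0, dist1 (GaugeField.gaugeAct û (GaugeField.gaugeAct r U₀) b) ≤
              (s + 2 * Real.pi * (((F.L : ℝ) ^ (K - J) * s + ((3 + 2) ^ 2 * (F.L : ℝ) / (2 * ((F.L : ℝ) - 1))) * (C_B * α)) + σV) *
                ((F.L : ℝ)⁻¹) ^ (K - J)) + 2 * Real.pi * τ' * ((F.L : ℝ)⁻¹) ^ (K - J)) ∧
            (∀ (x : Site (F.P K) 0) (w : List (Letter (F.P K).d)),
              dist1 (û x * (û (walkEnd x w))⁻¹) ≤ (w.length : ℝ) * (2 * Real.pi * τ' * ((F.L : ℝ)⁻¹) ^ (K - J))) := by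
  obtain ⟨r, hr, hmem, hσ⟩ := exists_smoothResidualCopy_of_letters F hJK hU₀ hgArc hCB hα hBKG hδ h6 hσV hτ0 hτ
  refine ⟨r, hr, hmem, hσ, fun t τ' hτ'0 hτ'8 hgrad => ?_⟩
  obtain ⟨û, hû, hγ⟩ := exists_lipschitzLift F hJK t hτ'0 hτ'8 hgrad
  exact ⟨û, hû, fun b => dist1_movedCopyRel_le_SU hσ hγ b, dist1_gaugeAct_le_of_bounds hσ hγ, walkGrad_le_of_bondGrad hγ⟩

end Package

end Summit.QuantumFields.YangMills.Theorems.FluctuationComparisonRegPrIntLS2BetaSmoothMovedSizes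

end
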